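import Summits.Ventures.PercRepro.C025ProfileThinHallLevel
import Summits.Ventures.PercRepro.C025ProfileThinSimplificationRows

/-!
# THE PROFILE CONJECTURE (C-032) AND ITS HALL FORM (C-033) REDUCE TO SIMPLE MATROIDS (night-3 g17)
The single-element steps of the row `(q, u)` and of its Hall form hold on every finite matroid at every level (`profileIneq_of_isLoop`,
`profileIneq_of_parallel_level`; `hallIneq_of_isLoop`, `hallIneq_of_parallel_level`), and the rows `(0, v)` hold on every matroid
(g6's `profileHall_zero`).  Hence:
* **`profileIneq_level_of_simple`** / **`hallIneq_level_of_simple`** (`q u`, `q + 1 ≤ u`): the row `(q+1, u+1)` on every matroid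
  follows from its simple case and the row `(q, u)` on every matroid (strong induction on `|E|`);
* **`profileIneq_all_of_simple`** / **`hallIneq_all_of_simple`**: if the rows `(q, u)`, `q < u`, hold on every SIMPLE finite matroid
  (over `α`), they hold on every finite matroid over `α` (induction on `q`);
* **`c025Profile_of_simple`** / **`profileHall_of_simple`**: `C025Profile` (the whole profile conjecture) and `ProfileHall` (its Hall
  form) follow from their statements on simple matroids — loops and parallel classes never matter for C-032 / C-033.
No `def`, no `instance`, no notation.  Axioms: standard.
-/
open scoped Matroid
namespace PercRepro
open Set Finset ThmH Staged
namespace ThinGirth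
variable {α : Type} [DecidableEq α]

/-- **The row `(q+1, u+1)` on every matroid from its simple case and the row `(q, u)` on every matroid.** -/
theorem profileIneq_level_of_simple (q u : ℕ) (hqu : q + 1 ≤ u)
    (hprev : ∀ (N : Matroid α) [N.Finite], Profile.ProfileIneq N q u)
    (hsimple : ∀ (N : Matroid α) [N.Finite], (∀ T ⊆ N.E, T.encard ≤ 2 → N.Indep T) →
      Profile.ProfileIneq N (q + 1) (u + 1)) :
    ∀ (M : Matroid α) [M.Finite], Profile.ProfileIneq M (q + 1) (u + 1) := by
  suffices H : ∀ n : ℕ, ∀ (M : Matroid α) [M.Finite], M.E.ncard = n → Profile.ProfileIneq M (q + 1) (u + 1) from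
    fun M _ => H _ M rfl
  intro n
  induction n using Nat.strong_induction_on with
  | _ n ih =>
  intro M _ hn
  have hdel : ∀ e ∈ M.E, (M ＼ {e}).E.ncard < n := by
    intro e he
    rw [Matroid.delete_ground, ← hn, ← Set.ncard_sdiff_singleton_add_one he M.ground_finite]
    omega
  by_cases hloop : ∃ e, M.IsLoop e
  · obtain ⟨e, he⟩ := hloop
    exact profileIneq_of_isLoop he (ih _ (hdel e he.mem_ground) (M ＼ {e}) rfl)
  have hnl : ∀ x ∈ M.E, M.Indep {x} := by
    intro x hx
    exact Matroid.indep_singleton.2 ((Matroid.not_isLoop_iff hx).1 (fun h => hloop ⟨x, h⟩))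
  by_cases hs : ∀ T ⊆ M.E, T.encard ≤ 2 → M.Indep T
  · exact hsimple M hs
  obtain ⟨e, e', heE, he'E, hne, _, hpar'⟩ := exists_parallel_of_not_simple hnl hs
  exact profileIneq_of_parallel_level (hnl e heE) (hnl e' he'E) hne.symm hpar' q u hqu
    (ih _ (hdel e' he'E) (M ＼ {e'}) rfl) (hprev ((M ／ {e}) ＼ {e'}))

/-- **The Hall form `(H⁺_{q+1,u+1})` on every matroid from its simple case and `(H⁺_{q,u})` on every matroid.** -/
theorem hallIneq_level_of_simple (q u : ℕ) (hqu : q + 1 ≤ u)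
    (hprev : ∀ (N : Matroid α) [N.Finite], Profile.HallIneq N q u)
    (hsimple : ∀ (N : Matroid α) [N.Finite], (∀ T ⊆ N.E, T.encard ≤ 2 → N.Indep T) →
      Profile.HallIneq N (q + 1) (u + 1)) :
    ∀ (M : Matroid α) [M.Finite], Profile.HallIneq M (q + 1) (u + 1) := by
  suffices H : ∀ n : ℕ, ∀ (M : Matroid α) [M.Finite], M.E.ncard = n → Profile.HallIneq M (q + 1) (u + 1) from
    fun M _ => H _ M rfl
  intro n
  induction n using Nat.strong_induction_on with
  | _ n ih =>
  intro M _ hn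
  have hdel : ∀ e ∈ M.E, (M ＼ {e}).E.ncard < n := by
    intro e he
    rw [Matroid.delete_ground, ← hn, ← Set.ncard_sdiff_singleton_add_one he M.ground_finite]
    omega
  by_cases hloop : ∃ e, M.IsLoop e
  · obtain ⟨e, he⟩ := hloop
    exact hallIneq_of_isLoop he (ih _ (hdel e he.mem_ground) (M ＼ {e}) rfl)
  have hnl : ∀ x ∈ M.E, M.Indep {x} := by
    intro x hx
    exact Matroid.indep_singleton.2 ((Matroid.not_isLoop_iff hx).1 (fun h => hloop ⟨x, h⟩))
  by_cases hs : ∀ T ⊆ M.E, T.encard ≤ 2 → M.Indep T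
  · exact hsimple M hs
  obtain ⟨e, e', heE, he'E, hne, _, hpar'⟩ := exists_parallel_of_not_simple hnl hs
  exact hallIneq_of_parallel_level (hnl e heE) (hnl e' he'E) hne.symm hpar' q u hqu
    (ih _ (hdel e' he'E) (M ＼ {e'}) rfl) (hprev ((M ／ {e}) ＼ {e'}))

/-- **THE PROFILE CONJECTURE REDUCES TO SIMPLE MATROIDS** (over `α`): if every simple finite matroid satisfies the rows `(q, u)`, `q < u`,
so does every finite matroid. -/
theorem profileIneq_all_of_simple
    (hsimple : ∀ (N : Matroid α) [N.Finite], (∀ T ⊆ N.E, T.encard ≤ 2 → N.Indep T) →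
      ∀ q u : ℕ, q < u → Profile.ProfileIneq N q u) :
    ∀ (q u : ℕ), q < u → ∀ (M : Matroid α) [M.Finite], Profile.ProfileIneq M q u := by
  intro q
  induction q with
  | zero => exact fun u _ M _ => profileIneq_zero u
  | succ q ih =>
    intro u hqu M _
    obtain ⟨u', rfl⟩ : ∃ u', u = u' + 1 := ⟨u - 1, by omega⟩
    exact profileIneq_level_of_simple q u' (by omega) (fun N _ => ih u' (by omega) N)
      (fun N _ hs => hsimple N hs (q + 1) (u' + 1) (by omega)) M

/-- **THE HALL FORM REDUCES TO SIMPLE MATROIDS** (over `α`). -/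
theorem hallIneq_all_of_simple
    (hsimple : ∀ (N : Matroid α) [N.Finite], (∀ T ⊆ N.E, T.encard ≤ 2 → N.Indep T) →
      ∀ q u : ℕ, q < u → Profile.HallIneq N q u) :
    ∀ (q u : ℕ), q < u → ∀ (M : Matroid α) [M.Finite], Profile.HallIneq M q u := by
  intro q
  induction q with
  | zero => exact fun u _ M _ => hallIneq_zero u
  | succ q ih =>
    intro u hqu M _
    obtain ⟨u', rfl⟩ : ∃ u', u = u' + 1 := ⟨u - 1, by omega⟩
    exact hallIneq_level_of_simple q u' (by omega) (fun N _ => ih u' (by omega) N)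
      (fun N _ hs => hsimple N hs (q + 1) (u' + 1) (by omega)) M

end ThinGirth

/-- **`C025Profile` FROM ITS SIMPLE CASE**: the profile conjecture for every finite matroid follows from the rows on simple matroids. -/
theorem c025Profile_of_simple
    (hsimple : ∀ {α : Type} [DecidableEq α] (N : Matroid α) [N.Finite], (∀ T ⊆ N.E, T.encard ≤ 2 → N.Indep T) →
      ∀ q u : ℕ, q < u → Profile.ProfileIneq N q u) : C025Profile :=
  fun {_} _ M _ q u hqu => ThinGirth.profileIneq_all_of_simple (fun N _ hs => hsimple N hs) q u hqu M

/-- **`ProfileHall` FROM ITS SIMPLE CASE**: the Hall form of the profile conjecture follows from its simple case. -/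
theorem profileHall_of_simple
    (hsimple : ∀ {α : Type} [DecidableEq α] (N : Matroid α) [N.Finite], (∀ T ⊆ N.E, T.encard ≤ 2 → N.Indep T) →
      ∀ q u : ℕ, q < u → Profile.HallIneq N q u) : ProfileHall :=
  fun {_} _ M _ q u hqu => ThinGirth.hallIneq_all_of_simple (fun N _ hs => hsimple N hs) q u hqu M

end PercRepro
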